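import Summits.Ventures.LatticeQCDFlow.Scaling.HubChainPerStepDomination

/-!
HONEST FRAMING: exact (Metropolis-corrected) sampling algorithms for lattice gauge theory; figures
of merit are autocorrelation/cost numbers at stated couplings and volumes; no continuum-physics
claim.

# HubChainStartContentDeficit — WHAT IS LEFT OF PER-STEP DOMINATION AT THE START CLASS: THE DIAGONAL DIFFERENCE IS `N_iρ_i(T^Y_n(i) − T^X_n(i)) + ((β^Y_i)ⁿ − (β^X_i)ⁿ)`; ITS FIRST
# PART IS `≤ 0` (Z2), SO AT A START DEEPER THAN THE TAG THE PER-STEP DEFICIT IS AT MOST THE PARITY TERM `(max{0, −β^Y_i})ⁿ ≤ cⁿ` (`= K⁻ⁿ` FOR THE STAR), AND AT A START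
# SHALLOWER THAN THE TAG THERE IS NONE (lean-2 GEN-40, ours)

Venture-side (OURS).  Cell `lqcd-flow` (pub-lqcd), unit `pub-lqcd-lean-2-g40`, 2026-08-30.  Chapter Z, file 5.  Setting of Z2 (class chain, two sorted depth profiles agreeing off the tag
rank `s`, `ρ^X_s ≤ ρ^Y_s`).  Route (β) of OPEN-MATH (b′) (MEMO-gen38∕39) uses the `j`-attempt laws from the start class; by Z2–Z4 their domination defect vanishes at every class but the
start class `i` itself (Y5: it does not vanish there).  Here the start class is quantified:

* `startClass_diag_sub`: `P_Yⁿ(i,i) − P_Xⁿ(i,i) = N_iρ_i(T^Y_n(i) − T^X_n(i)) + ((β^Y_i)ⁿ − (β^X_i)ⁿ)` (Y8's diagonal form, `ρ_i` common for `i ≠ s`);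
* `startClass_deep_sub_le`: for a start DEEPER than the tag (`s < i`, three particles at ranks `≤ i`): `P_Yⁿ(i,i) − P_Xⁿ(i,i) ≤ (β^Y_i)ⁿ − (β^X_i)ⁿ` (Z2 `perStep_T_le_deep`), where
  `β^Y_i ≤ β^X_i` (Z2 `perStep_beta_le`) — negative for odd `n`, and for even `n` positive only through NEGATIVE eigenvalues (the self-exclusion parity of Y5);
* `pow_sub_pow_le_negPart_pow`: `v ≤ u ⇒ vⁿ − uⁿ ≤ (max{0,−v})ⁿ` (real lemma, by parity);
* **`startClass_deficit_le`**: `P_Yⁿ(i,i) − P_Xⁿ(i,i) ≤ (max{0, −β^Y_i})ⁿ` with **`startClass_negPart_le`**: `−β^Y_i ≤ cM_0 − 1`, `max{0,−β^Y_i} ≤ c` (`= 1/K` for the star's `c = 1/K`,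
  `M_0 = K+1`): the per-step deficit at a deep start is at most `K⁻ⁿ`, and it is ZERO whenever `β^Y_i ≥ 0` (`startClass_deep_le_of_nonneg`);
* (shallow start, `i < s`: NO deficit — Z2 `perStep_pow_diag_le`.)

What this leaves for route (β) (memo MEMO-gen40, §4): with the per-`j` gain `G_j = x_j(★) + x_j(a) − y_j(a) − Σ_{c∉{a,b}}(y_j(c) − x_j(c))⁺` (W15 per law) and Z4, the `σ`-weighted
gain is `x̃(★) + x̃(a) − ỹ(a) − D`, `D = Σ_j(1−σ)σʲ⁻¹(y_j(ζ) − x_j(ζ))⁺` the discounted START-CONTENT DEFICIT, bounded here termwise; the sharp step law follows as soon as `D` is absorbed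
by the slack `x̃(a) − ỹ(a)` + the slack of chapter W's linear chain (toy in the memo).  Literature grade (cell rule): OWN, elementary; nothing cited; no new bib keys.
-/

open Finset

namespace Summit.Ventures.LatticeQCDFlow.Scaling

/-! ### §1 A parity lemma -/
section Parity

/-- **`v ≤ u ⇒ vⁿ − uⁿ ≤ (max{0,−v})ⁿ`** (for `v ≥ 0` the left side is `≤ 0`; for `v < 0 ≤ u` it is `≤ vⁿ ≤ |v|ⁿ`; for `v ≤ u < 0` by parity). [ours] -/
theorem pow_sub_pow_le_negPart_pow {u v : ℝ} (hvu : v ≤ u) (n : ℕ) : v ^ n - u ^ n ≤ (max 0 (-v)) ^ n := by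
  rcases le_or_gt 0 v with hv | hv
  · -- `0 ≤ v ≤ u`
    rw [max_eq_left (by linarith : -v ≤ 0)]
    have h := pow_le_pow_left₀ hv hvu n
    rcases n with _ | n
    · simp
    · rw [zero_pow (Nat.succ_ne_zero n)]; linarith
  · rw [max_eq_right (by linarith : (0:ℝ) ≤ -v)]
    -- `vⁿ − (−v)ⁿ ≤ uⁿ`
    rcases Nat.even_or_odd n with he | ho
    · rw [he.neg_pow]; linarith [he.pow_nonneg u]
    · rw [ho.neg_pow]
      have hmono : v ^ n ≤ u ^ n := (ho.strictMono_pow (R := ℝ)).monotone hvu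
      have hvn : v ^ n ≤ 0 := (ho.pow_neg hv).le
      linarith

/-- `(max{0,−v})ⁿ ≤ qⁿ` whenever `−v ≤ q` and `0 ≤ q`. [ours] -/
theorem negPart_pow_le {v q : ℝ} (hq : 0 ≤ q) (hvq : -v ≤ q) (n : ℕ) : (max 0 (-v)) ^ n ≤ q ^ n :=
  pow_le_pow_left₀ (le_max_left _ _) (max_le hq hvq) n

end Parity

/-! ### §2 The start class -/
section StartClass
variable {m s : ℕ} {ρX ρY N RX RY M βX βY a : ℕ → ℝ} {c : ℝ} {PX PY fX fY : ℕ → ℕ → ℝ} {PnX PnY : ℕ → ℕ → ℕ → ℝ} {TX TY : ℕ → ℕ → ℝ}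

/-- **The diagonal difference:** for a class `i ≠ s`, `P_Yⁿ(i,i) − P_Xⁿ(i,i) = N_iρ_i(T^Y_n(i) − T^X_n(i)) + ((β^Y_i)ⁿ − (β^X_i)ⁿ)`. [ours] -/
theorem startClass_diag_sub (hρX : ∀ i, 0 < ρX i) (hmonoX : Monotone ρX) (hρY : ∀ i, 0 < ρY i) (hmonoY : Monotone ρY)
    (hagree : ∀ i, i ≠ s → ρX i = ρY i) (hN : ∀ i, 0 < N i)
    (hRX : ∀ k, RX k = ∑ i ∈ range k, N i * ρX i) (hRY : ∀ k, RY k = ∑ i ∈ range k, N i * ρY i) (hM : ∀ k, M k = ∑ i ∈ Ico k m, N i)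
    (hPXoff : ∀ i j, i ≠ j → PX i j = c * N j * min 1 (ρX j / ρX i)) (hPXdiag : ∀ i, PX i i = 1 - ∑ j ∈ (range m).erase i, PX i j)
    (hPYoff : ∀ i j, i ≠ j → PY i j = c * N j * min 1 (ρY j / ρY i)) (hPYdiag : ∀ i, PY i i = 1 - ∑ j ∈ (range m).erase i, PY i j)
    (hfX : ∀ k i, fX k i = if i < k then ρX k else if i = k then -(RX k / N k) else 0)
    (hfY : ∀ k i, fY k i = if i < k then ρY k else if i = k then -(RY k / N k) else 0)
    (hβX : ∀ k, βX k = 1 - c * (M k + RX k / ρX k)) (hβY : ∀ k, βY k = 1 - c * (M k + RY k / ρY k))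
    (hPX0 : ∀ i j, PnX 0 i j = if i = j then 1 else 0) (hPXs : ∀ n i j, PnX (n + 1) i j = ∑ l ∈ range m, PnX n i l * PX l j)
    (hPY0 : ∀ i j, PnY 0 i j = if i = j then 1 else 0) (hPYs : ∀ n i j, PnY (n + 1) i j = ∑ l ∈ range m, PnY n i l * PY l j)
    (hTX : ∀ n j, TX n j = (1 - βX j ^ n) / RX m + ∑ k ∈ Ico (j + 1) m, (1 / RX k - 1 / RX (k + 1)) * (βX k ^ n - βX j ^ n))
    (hTY : ∀ n j, TY n j = (1 - βY j ^ n) / RY m + ∑ k ∈ Ico (j + 1) m, (1 / RY k - 1 / RY (k + 1)) * (βY k ^ n - βY j ^ n))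
    (n : ℕ) {i : ℕ} (hi : i < m) (his : i ≠ s) :
    PnY n i i - PnX n i i = N i * ρX i * (TY n i - TX n i) + (βY i ^ n - βX i ^ n) := by
  rw [hubClass_pow_diag hρX hmonoX hN hRX hM hPXoff hPXdiag hfX hβX hPX0 hPXs hTX n hi,
    hubClass_pow_diag hρY hmonoY hN hRY hM hPYoff hPYdiag hfY hβY hPY0 hPYs hTY n hi, ← hagree i his]
  ring

/-- **At a start deeper than the tag the `T`-part is `≤ 0`:** for `s < i` with three particles at ranks `≤ i`, `P_Yⁿ(i,i) − P_Xⁿ(i,i) ≤ (β^Y_i)ⁿ − (β^X_i)ⁿ`. [ours] -/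
theorem startClass_deep_sub_le (hρX : ∀ i, 0 < ρX i) (hmonoX : Monotone ρX) (hρY : ∀ i, 0 < ρY i) (hmonoY : Monotone ρY)
    (hagree : ∀ i, i ≠ s → ρX i = ρY i) (htag : ρX s ≤ ρY s) (hN : ∀ i, 0 < N i)
    (hRX : ∀ k, RX k = ∑ i ∈ range k, N i * ρX i) (hRY : ∀ k, RY k = ∑ i ∈ range k, N i * ρY i) (hM : ∀ k, M k = ∑ i ∈ Ico k m, N i)
    (hPXoff : ∀ i j, i ≠ j → PX i j = c * N j * min 1 (ρX j / ρX i)) (hPXdiag : ∀ i, PX i i = 1 - ∑ j ∈ (range m).erase i, PX i j)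
    (hPYoff : ∀ i j, i ≠ j → PY i j = c * N j * min 1 (ρY j / ρY i)) (hPYdiag : ∀ i, PY i i = 1 - ∑ j ∈ (range m).erase i, PY i j)
    (hfX : ∀ k i, fX k i = if i < k then ρX k else if i = k then -(RX k / N k) else 0)
    (hfY : ∀ k i, fY k i = if i < k then ρY k else if i = k then -(RY k / N k) else 0)
    (hβX : ∀ k, βX k = 1 - c * (M k + RX k / ρX k)) (hβY : ∀ k, βY k = 1 - c * (M k + RY k / ρY k)) (ha : ∀ l, a l = 1 - c * M (l + 1))
    (hPX0 : ∀ i j, PnX 0 i j = if i = j then 1 else 0) (hPXs : ∀ n i j, PnX (n + 1) i j = ∑ l ∈ range m, PnX n i l * PX l j)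
    (hPY0 : ∀ i j, PnY 0 i j = if i = j then 1 else 0) (hPYs : ∀ n i j, PnY (n + 1) i j = ∑ l ∈ range m, PnY n i l * PY l j)
    (hTX : ∀ n j, TX n j = (1 - βX j ^ n) / RX m + ∑ k ∈ Ico (j + 1) m, (1 / RX k - 1 / RX (k + 1)) * (βX k ^ n - βX j ^ n))
    (hTY : ∀ n j, TY n j = (1 - βY j ^ n) / RY m + ∑ k ∈ Ico (j + 1) m, (1 / RY k - 1 / RY (k + 1)) * (βY k ^ n - βY j ^ n))
    (hc : 0 ≤ c) (hcK : c * M 0 ≤ 1 + c) (n : ℕ) {i : ℕ} (hsi : s < i) (hi : i < m) (h3 : M (i + 1) + 3 ≤ M 0) :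
    PnY n i i - PnX n i i ≤ βY i ^ n - βX i ^ n := by
  rw [startClass_diag_sub hρX hmonoX hρY hmonoY hagree hN hRX hRY hM hPXoff hPXdiag hPYoff hPYdiag hfX hfY hβX hβY hPX0 hPXs hPY0 hPYs hTX hTY n hi (ne_of_gt hsi)]
  have hT := perStep_T_le_deep hρX hρY hmonoY hagree htag hN hRX hRY hM hβX hβY ha hTX hTY hc hcK n hsi hi h3
  nlinarith [mul_pos (hN i) (hρX i)]

/-- **THE PER-STEP START-CLASS DEFICIT AT A DEEP START:** `P_Yⁿ(i,i) − P_Xⁿ(i,i) ≤ (max{0, −β^Y_i})ⁿ` — zero unless the eigenvalue at the start class is negative. [ours] -/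
theorem startClass_deficit_le (hρX : ∀ i, 0 < ρX i) (hmonoX : Monotone ρX) (hρY : ∀ i, 0 < ρY i) (hmonoY : Monotone ρY)
    (hagree : ∀ i, i ≠ s → ρX i = ρY i) (htag : ρX s ≤ ρY s) (hN : ∀ i, 0 < N i)
    (hRX : ∀ k, RX k = ∑ i ∈ range k, N i * ρX i) (hRY : ∀ k, RY k = ∑ i ∈ range k, N i * ρY i) (hM : ∀ k, M k = ∑ i ∈ Ico k m, N i)
    (hPXoff : ∀ i j, i ≠ j → PX i j = c * N j * min 1 (ρX j / ρX i)) (hPXdiag : ∀ i, PX i i = 1 - ∑ j ∈ (range m).erase i, PX i j)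
    (hPYoff : ∀ i j, i ≠ j → PY i j = c * N j * min 1 (ρY j / ρY i)) (hPYdiag : ∀ i, PY i i = 1 - ∑ j ∈ (range m).erase i, PY i j)
    (hfX : ∀ k i, fX k i = if i < k then ρX k else if i = k then -(RX k / N k) else 0)
    (hfY : ∀ k i, fY k i = if i < k then ρY k else if i = k then -(RY k / N k) else 0)
    (hβX : ∀ k, βX k = 1 - c * (M k + RX k / ρX k)) (hβY : ∀ k, βY k = 1 - c * (M k + RY k / ρY k)) (ha : ∀ l, a l = 1 - c * M (l + 1))
    (hPX0 : ∀ i j, PnX 0 i j = if i = j then 1 else 0) (hPXs : ∀ n i j, PnX (n + 1) i j = ∑ l ∈ range m, PnX n i l * PX l j)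
    (hPY0 : ∀ i j, PnY 0 i j = if i = j then 1 else 0) (hPYs : ∀ n i j, PnY (n + 1) i j = ∑ l ∈ range m, PnY n i l * PY l j)
    (hTX : ∀ n j, TX n j = (1 - βX j ^ n) / RX m + ∑ k ∈ Ico (j + 1) m, (1 / RX k - 1 / RX (k + 1)) * (βX k ^ n - βX j ^ n))
    (hTY : ∀ n j, TY n j = (1 - βY j ^ n) / RY m + ∑ k ∈ Ico (j + 1) m, (1 / RY k - 1 / RY (k + 1)) * (βY k ^ n - βY j ^ n))
    (hc : 0 ≤ c) (hcK : c * M 0 ≤ 1 + c) (n : ℕ) {i : ℕ} (hsi : s < i) (hi : i < m) (h3 : M (i + 1) + 3 ≤ M 0) :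
    PnY n i i - PnX n i i ≤ (max 0 (-βY i)) ^ n :=
  (startClass_deep_sub_le hρX hmonoX hρY hmonoY hagree htag hN hRX hRY hM hPXoff hPXdiag hPYoff hPYdiag hfX hfY hβX hβY ha hPX0 hPXs hPY0 hPYs hTX hTY hc hcK n hsi hi h3).trans
    (pow_sub_pow_le_negPart_pow (perStep_beta_le hρY hagree htag hN hRX hRY hβX hβY hc hsi) n)

/-- **The size of the parity term:** `−β^Y_i ≤ cM_0 − 1` (`β ≥ 1 − cM_0`, Y7), hence `max{0,−β^Y_i} ≤ c` under `cM_0 ≤ 1 + c` — for the star (`c = 1/K`, `M_0 = K+1`) the per-step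
start-class deficit is at most `K⁻ⁿ`. [ours] -/
theorem startClass_negPart_le (hρY : ∀ i, 0 < ρY i) (hmonoY : Monotone ρY) (hN : ∀ i, 0 < N i)
    (hRY : ∀ k, RY k = ∑ i ∈ range k, N i * ρY i) (hM : ∀ k, M k = ∑ i ∈ Ico k m, N i)
    (hβY : ∀ k, βY k = 1 - c * (M k + RY k / ρY k)) (hc : 0 ≤ c) (hcK : c * M 0 ≤ 1 + c) {i : ℕ} (hi : i < m) :
    -βY i ≤ c * M 0 - 1 ∧ max 0 (-βY i) ≤ c := by
  have hβ := hubClass_beta_ge hρY hmonoY hN hRY hM hβY hc hi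
  exact ⟨by linarith, max_le hc (by linarith)⟩

/-- **No deficit at a deep start with non-negative eigenvalue:** `β^Y_i ≥ 0 ⇒ P_Yⁿ(i,i) ≤ P_Xⁿ(i,i)`. [ours] -/
theorem startClass_deep_le_of_nonneg (hρX : ∀ i, 0 < ρX i) (hmonoX : Monotone ρX) (hρY : ∀ i, 0 < ρY i) (hmonoY : Monotone ρY)
    (hagree : ∀ i, i ≠ s → ρX i = ρY i) (htag : ρX s ≤ ρY s) (hN : ∀ i, 0 < N i)
    (hRX : ∀ k, RX k = ∑ i ∈ range k, N i * ρX i) (hRY : ∀ k, RY k = ∑ i ∈ range k, N i * ρY i) (hM : ∀ k, M k = ∑ i ∈ Ico k m, N i)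
    (hPXoff : ∀ i j, i ≠ j → PX i j = c * N j * min 1 (ρX j / ρX i)) (hPXdiag : ∀ i, PX i i = 1 - ∑ j ∈ (range m).erase i, PX i j)
    (hPYoff : ∀ i j, i ≠ j → PY i j = c * N j * min 1 (ρY j / ρY i)) (hPYdiag : ∀ i, PY i i = 1 - ∑ j ∈ (range m).erase i, PY i j)
    (hfX : ∀ k i, fX k i = if i < k then ρX k else if i = k then -(RX k / N k) else 0)
    (hfY : ∀ k i, fY k i = if i < k then ρY k else if i = k then -(RY k / N k) else 0)
    (hβX : ∀ k, βX k = 1 - c * (M k + RX k / ρX k)) (hβY : ∀ k, βY k = 1 - c * (M k + RY k / ρY k)) (ha : ∀ l, a l = 1 - c * M (l + 1))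
    (hPX0 : ∀ i j, PnX 0 i j = if i = j then 1 else 0) (hPXs : ∀ n i j, PnX (n + 1) i j = ∑ l ∈ range m, PnX n i l * PX l j)
    (hPY0 : ∀ i j, PnY 0 i j = if i = j then 1 else 0) (hPYs : ∀ n i j, PnY (n + 1) i j = ∑ l ∈ range m, PnY n i l * PY l j)
    (hTX : ∀ n j, TX n j = (1 - βX j ^ n) / RX m + ∑ k ∈ Ico (j + 1) m, (1 / RX k - 1 / RX (k + 1)) * (βX k ^ n - βX j ^ n))
    (hTY : ∀ n j, TY n j = (1 - βY j ^ n) / RY m + ∑ k ∈ Ico (j + 1) m, (1 / RY k - 1 / RY (k + 1)) * (βY k ^ n - βY j ^ n))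
    (hc : 0 ≤ c) (hcK : c * M 0 ≤ 1 + c) (n : ℕ) {i : ℕ} (hsi : s < i) (hi : i < m) (h3 : M (i + 1) + 3 ≤ M 0) (hβpos : 0 ≤ βY i) :
    PnY n i i ≤ PnX n i i := by
  have h := startClass_deep_sub_le hρX hmonoX hρY hmonoY hagree htag hN hRX hRY hM hPXoff hPXdiag hPYoff hPYdiag hfX hfY hβX hβY ha hPX0 hPXs hPY0 hPYs hTX hTY hc hcK n hsi hi h3
  have hβle := perStep_beta_le hρY hagree htag hN hRX hRY hβX hβY hc hsi
  have := pow_le_pow_left₀ hβpos hβle n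
  linarith

end StartClass

end Summit.Ventures.LatticeQCDFlow.Scaling
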